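import Summits.CriticalPhenomena.PercolationContinuityZ3.Theorems.PercNearOneGluingNoHeavyQuantLightSiblingCore
import Summits.CriticalPhenomena.PercolationContinuityZ3.Theorems.PercNearOneGluingNoHeavyQuantGateMoveRelayStar
import HarnessLib

/-!
# QUANT lane R8, T-DEC: FORESTS OF TAME SIBLINGS ARE SDEC, k-GENERAL — I-b. the heavy-but-floored branch: sure relays and a blob
# with gate `≥ x` beside an SDEC law (arm-1 gen 56, architect)

builds on p205010 (kernel theorem, internal audit signed; external expert review pending)

Support file (`--supports stmt-CriticalPhenomena-4575`), QUANT lane seat prim-quant-arm-1 (gen 56, architect); memo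
`run/shared/lean/prim/quant/prim-quant-arm-1-g56/ARCH-G56.md` §3.  Theorems only (file-local notation, no definitions); standard axioms, no
sorries.  Consumer: `…QuantLightSiblingForest`.

In the canonical two-point decomposition of a sibling's gated law (Lemma P), a component `{lo, hi; γ}` with `lo ≥ 1` is `lo` SURE RELAYS and a blob
of size `K = hi − lo` at gate `γ`.  When the component is light (`Kγ ≤ lo`) it joins the hub-core (`…QuantLightSiblingCore`); when it is
heavy but its gate is NOT below the floor (`γ ≥ x` — census-1 g28's floor condition `x·(M − lo) ≤ m − lo` guarantees it, since
`γ = (m − lo)/(hi − lo)` and `hi ≤ M`) it is absorbed by the existing slice lemmas: `lo` relay slices at gate `1` (`sdec_slice_relays`, this lane's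
`…QuantGateMoveRelayStar`) followed by one heavy-blob slice (`sdec_slice_blob_of_mixLaw'` + `gatedSliceMixLaw'_holds`).  This file does the
bookkeeping: `δ_{lo}` as `lo` relay slices (`foldr_slice_one_eq_lconv_point`), **`sdec_lconv_point`** (SDEC is closed under convolution with
`δ_lo`), **`sdec_lconv_lconv_relaysBlob`** (the branch, with top padding).

HONEST STATUS.  Tools; `SiblingStep` / `GateStepN` / `LightResidDECOracle` / `FarTreeRow` OPEN; RATE class (log\*) / honest sentence of
`run/shared/lean/prim/quant/README.md` unchanged.  [this work].  Nothing here is cited as a published result.  The gluing rows served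
[cite: KozmaNitzan2024, Conjecture 3 (p. 15)]; product measure [cite: Grimmett1999, §1.3 p. 10].
-/

noncomputable section

open scoped BigOperators

namespace Summit.CriticalPhenomena.PercolationContinuityZ3.Theorems
namespace Quant
namespace LawDec

open Finset

/-- the point mass `δ_K` -/
local notation3 "δ[" K "]" => (fun k : ℕ => if k = (K : ℕ) then (1 : ℝ) else 0)

/-- the two-point law `{lo, lo+K; g}` = `lo` sure relays and a blob of size `K` at gate `g` -/
local notation3 "TPL[" lo ", " K ", " g "]" => lconv lo K δ[lo] (gate δ[K] g)

/-! ### `δ_lo` as `lo` relay slices -/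

/-- one more sure relay: `μ ∗ δ_{lo+1} = slice (μ ∗ δ_lo) 1 1`. [this work] -/
theorem lconv_point_succ (M n : ℕ) (μ : ℕ → ℝ) :
    lconv M (n + 1) μ δ[n + 1] = slice (lconv M n μ δ[n]) 1 1 := by
  have e : (δ[n + 1]) = lconv n 1 δ[n] (gate δ[1] 1) := by
    rw [lconv_gate_point_eq_slice n 1 _ 1 (fun k hk => if_neg (by omega))]
    funext h
    simp only [slice, sub_self, zero_mul, zero_add, one_mul]
    by_cases h1 : h = n + 1
    · rw [if_pos h1, if_pos (by omega), if_pos (by omega)]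
    · rw [if_neg h1]
      by_cases h2 : 1 ≤ h
      · rw [if_pos h2, if_neg (by omega)]
      · rw [if_neg h2]
  rw [e, lconv_assoc, lconv_gate_point_eq_slice _ 1 _ 1 (fun k hk => lconv_eq_zero _ _ _ _ k hk)]

/-- `n` relay slices at gate `1` = convolution with `δ_n` (for a law vanishing above its top `M`). [this work] -/
theorem foldr_slice_one_eq_lconv_point (M : ℕ) (μ : ℕ → ℝ) (hμM : ∀ h, M < h → μ h = 0) :
    ∀ n : ℕ, (List.replicate n (1 : ℝ)).foldr (fun g L => slice L 1 g) μ = lconv M n μ δ[n]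
  | 0 => by
    rw [List.replicate_zero, List.foldr_nil]
    exact (funext fun h => lconv_delta_right M 0 μ hμM h).symm
  | n + 1 => by
    rw [List.replicate_succ, List.foldr_cons, foldr_slice_one_eq_lconv_point M μ hμM n, lconv_point_succ]

/-- **SDEC is closed under convolution with `δ_lo`** (`lo` sure relays beside a top-affordable SDEC probability law; `sdec_slice_relays` with all
gates `1`), together with the law facts of `μ ∗ δ_lo`. [this work] -/
theorem sdec_lconv_point {x : ℝ} {M : ℕ} {μ : ℕ → ℝ} (hx0 : 0 < x) (hx1 : x < 1) (lo : ℕ) (hμ0 : ∀ h, 0 ≤ μ h)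
    (hμM : ∀ h, M < h → μ h = 0) (hμ1 : ∑ h ∈ Finset.range (M + 1), μ h = 1)
    (hta : x * (M : ℝ) ≤ ∑ h ∈ Finset.range (M + 1), (h : ℝ) * μ h) (hS : SDEC x M μ) :
    (∀ h, 0 ≤ lconv M lo μ δ[lo] h) ∧ (∀ h, M + lo < h → lconv M lo μ δ[lo] h = 0) ∧
    (∑ h ∈ Finset.range (M + lo + 1), lconv M lo μ δ[lo] h = 1) ∧
    (∑ h ∈ Finset.range (M + lo + 1), (h : ℝ) * lconv M lo μ δ[lo] h = ∑ h ∈ Finset.range (M + 1), (h : ℝ) * μ h + lo) ∧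
    SDEC x (M + lo) (lconv M lo μ δ[lo]) := by
  have p0 : ∀ h, 0 ≤ (δ[lo]) h := fun h => by positivity
  have p1 : ∑ h ∈ Finset.range (lo + 1), (δ[lo]) h = 1 := by simp
  have pmn : ∑ h ∈ Finset.range (lo + 1), (h : ℝ) * (δ[lo]) h = lo := by simp
  refine ⟨lconv_nonneg _ _ _ _ hμ0 p0, fun h hh => lconv_eq_zero _ _ _ _ h hh, sum_lconv _ _ _ _ hμ1 p1,
    by rw [sum_mul_lconv _ _ _ _ hμ1 p1, pmn], ?_⟩
  have h := sdec_slice_relays x hx0 hx1 (List.replicate lo (1 : ℝ)) (fun g hg => ?_) M μ hμ0 hμM hμ1 hta hS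
  · rwa [List.length_replicate, foldr_slice_one_eq_lconv_point M μ hμM lo] at h
  · rw [List.eq_of_mem_replicate hg]; exact ⟨hx1.le, le_rfl⟩

/-! ### The heavy-but-floored branch -/

/-- **sure relays and a floored blob beside an SDEC law**: for laws `α` on `{0..N}`, `β` on `{0..B}` with `α ∗ β` a probability law, top-affordable
and SDEC at `x`, and a component `{lo, lo+K; γ}` with `x ≤ γ ≤ 1`, `lo + K ≤ M`, `x·M ≤ lo + Kγ`: `α ∗ (β ∗ TPL[lo, K, γ])` (the sibling slot
declared on `{0..M}`) is SDEC at `x` on `{0..N+B+M}` — `lo` relay slices, one blob slice (if `K ≥ 1`), a raised top. [this work] -/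
theorem sdec_lconv_lconv_relaysBlob {x γ : ℝ} {N B lo K M : ℕ} {α β : ℕ → ℝ} (hx0 : 0 < x) (hx1 : x < 1) (hxγ : x ≤ γ) (hγ1 : γ ≤ 1)
    (hKM : lo + K ≤ M) (hpad : x * (M : ℝ) ≤ lo + K * γ)
    (a0 : ∀ h, 0 ≤ lconv N B α β h) (aM : ∀ h, N + B < h → lconv N B α β h = 0)
    (a1 : ∑ h ∈ Finset.range (N + B + 1), lconv N B α β h = 1)
    (ata : x * ((N + B : ℕ) : ℝ) ≤ ∑ h ∈ Finset.range (N + B + 1), (h : ℝ) * lconv N B α β h)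
    (hS : SDEC x (N + B) (lconv N B α β)) :
    SDEC x (N + (B + M)) (lconv N (B + M) α (lconv B M β (TPL[lo, K, γ]))) := by
  have hγ0 : 0 ≤ γ := hx0.le.trans hxγ
  obtain ⟨p0, pM, p1, pmn, _⟩ := hs_facts lo K γ hγ0 hγ1
  obtain ⟨d0, dM, d1⟩ := gate_laws K δ[K] γ hγ0 hγ1 (fun h => by positivity) (fun h hh => if_neg (by omega)) (by simp)
  have dmn : ∑ h ∈ Finset.range (K + 1), (h : ℝ) * gate δ[K] γ h = γ * K := by rw [sum_mul_gate]; simp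
  -- `α ∗ (β ∗ TPL) = ((α ∗ β) ∗ δ_lo) ∗ gate_γ δ_K`
  have e1 : lconv N (B + M) α (lconv B M β (TPL[lo, K, γ]))
      = lconv (N + B + lo) K (lconv (N + B) lo (lconv N B α β) δ[lo]) (gate δ[K] γ) := by
    have e0 : lconv B M β (TPL[lo, K, γ]) = lconv B (lo + K) β (TPL[lo, K, γ]) :=
      funext fun h => lconv_top_right_of_le _ (lo + K) M _ _ hKM pM h
    rw [e0]
    have e2 : lconv N (B + M) α (lconv B (lo + K) β (TPL[lo, K, γ])) = lconv N (B + (lo + K)) α (lconv B (lo + K) β (TPL[lo, K, γ])) :=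
      funext fun h => lconv_top_right_of_le _ (B + (lo + K)) (B + M) _ _ (by omega) (fun k hk => lconv_eq_zero _ _ _ _ k hk) h
    rw [e2, lconv_assoc N B (lo + K), lconv_assoc (N + B) lo K]
  rw [e1]
  obtain ⟨m0, mM, m1, mmn, mS⟩ := sdec_lconv_point hx0 hx1 lo a0 aM a1 ata hS
  have mta : x * ((N + B + lo : ℕ) : ℝ) ≤ ∑ h ∈ Finset.range (N + B + lo + 1), (h : ℝ) * lconv (N + B) lo (lconv N B α β) δ[lo] h := by
    rw [mmn]; push_cast at ata ⊢; nlinarith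
  -- the blob slice (or nothing if `K = 0`), at the top `N + B + lo + K`
  have h1 : SDEC x (N + B + lo + K) (lconv (N + B + lo) K (lconv (N + B) lo (lconv N B α β) δ[lo]) (gate δ[K] γ)) := by
    rcases Nat.eq_zero_or_pos K with hK | hK
    · subst hK
      have e : gate δ[0] γ = δ[0] := by funext h; rw [gate_apply]; split_ifs <;> ring
      rw [e, show lconv (N + B + lo) 0 (lconv (N + B) lo (lconv N B α β) δ[lo]) δ[0] = lconv (N + B) lo (lconv N B α β) δ[lo] from
        funext fun h => lconv_delta_right _ _ _ mM h, Nat.add_zero]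
      exact mS
    · rw [lconv_gate_point_eq_slice _ K _ γ mM]
      exact sdec_slice_blob_of_mixLaw' gatedSliceMixLaw'_holds x γ (N + B + lo) K _ hx0 hx1 hxγ hγ1 hK m0 mM m1 mta mS
  -- raise the declared top to `N + (B + M)`
  refine sdec_mono_top hx0 hx1 (lconv_nonneg _ _ _ _ m0 d0) (fun h hh => lconv_eq_zero _ _ _ _ h hh) (sum_lconv _ _ _ _ m1 d1)
    (by omega) ?_ h1
  rw [sum_mul_lconv _ _ _ _ m1 d1, mmn, dmn]
  push_cast at ata ⊢
  nlinarith

end LawDec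
end Quant
end Summit.CriticalPhenomena.PercolationContinuityZ3.Theorems
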